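import Summits.BirchSwinnertonDyer.BirchSwinnertonDyer.Theorems.ClassRecordThreeCornerAtThreeKolyImageCebotarevShift
import Summits.BirchSwinnertonDyer.BirchSwinnertonDyer.Theorems.ErratumRoadFiveShimuraKolyvaginOrderBoundInertShiftCebotarev
import Summits.BirchSwinnertonDyer.BirchSwinnertonDyer.Theorems.ErratumRoadFiveShimuraKolyvaginOrderBoundInertMachineEntry
import HarnessLib

/-!
# The IMAGE-KEYED Kolyvagin ORDER machine, I3: Kolyvagin's descent modulo `p^M` with Kolyvagin primes of depth
# `M + k` (`KolyvaginDescent.HypothesesM`, exponent form), from the four image inputs instead of `ρ̄_{E,p}` onto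
# (crux `CornerAtThree`, item stmt-BirchSwinnertonDyer-19111, conjunct 3 along the CARRIER-INERT Shimura road;
# cell `bsd-stepL`, seat `bsd-stepL-corner3-p2` g5 = WIDTH-LEVER lane B; `--supports … --as helper`)

HONEST FRAMING: THEOREMS ONLY (no definition, no named fact, no `sorry`); nothing here is a BSD class theorem;
no census label moves (T7); item 19111 is NOT closed; every statement is CONDITIONAL on its displayed binders
exactly as its `hρ`-keyed original. BSD is not proved by any of this.

## The series (why this file exists)

Lane B's typed object `Theorems.CornerAtThreeShimuraInertDisplay` (conjunct 1 of the registered stub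
`stub_upper3_inertDisplay` of `Cruxes/CornerAtThree/Lines/inert.lean`, planner RULING 35) is Kolyvagin's UNSHARP
order bound `#Ш(E/K)[3^∞] ≤ 3^(2·ord₃[E(K):ℤP])` for the CM point of `X_{N⁺,N⁻}` with `3 ∣ N⁻` on the (T4″)₃
corner (`E[3]` irreducible, `ρ̄_{E,3}` NOT onto). The tree's Shimura–Kolyvagin ORDER chain
(`ErratumRoadFiveShimuraKolyvaginOrderBoundInert*`, `ClassRecordThreeShimuraKolyvaginOrderBoundAtThreeSurjOrderShift*`;
seats shim-p1 ∕ shim3a) is keyed on `hρ : ρ̄_{E,p}` ONTO, read ONLY through four consequences (seat shim3b g4 ∕ g5,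
memo `shim/SHIM3B-G5-NOTE-19616.md` §2 «execute only if a consumer appears» — the consumer is lane B's inert line):
(hIz) some `z ∈ Γ_K` acts as `−1` on `E(K̄)[p]`, (hIs) `E(K̄)[p]` is a simple `Γ_K`-module, (hIc) its
`Γ_K`-commutant is scalar, (hIt) `E(K)[p] = 0`. The series `ClassRecordThreeCornerAtThreeKolyImage*.lean`
(namespace `…Theorems.ShimuraKolyvaginOfImage`; theorem names = originals + `_ofImage`) re-keys the chain on these
four binders: statements and proofs are the originals VERBATIM with `hρ` replaced by `(hIz) (hIs) (hIc) (hIt)` and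
the image-reading leaves replaced by shim3b's landed twins (`ShimuraKolyvaginCebotarevOfImage.McCallum1991_cor_3_2_pow_of_image`,
`ShimuraKolyvaginCebotarevKernelOfImage.exists_kolyvaginPrime_gt_pow_kernel_of_image`,
`ShimuraKolyvaginFixedOfTorsion.{geomTorsion_pow_eq_zero_of_fixed, torsionH1OfDvd_pow_injective}_of_torsionBy_eq_bot`,
`KolyvaginDescent.*_of_torsionBy_eq_bot`). At `p = 3` the four inputs hold for EVERY irreducible `E[3]`
(`ShimuraKolyvaginOfImage.kolyvaginImageInputs_three_of_mem_inertSet`, p563651), so the re-keyed END serves the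
corner; at `p ∈ {5, 7}` they hold on the non-surjective corners given `−1 ∈ ρ̄(Γ_ℚ)` (shim3b
`McCallum1991_cor_3_2_pow_of_irr_of_neg`). No new mathematics is claimed in the re-keyed files.

## THIS FILE = I3 of shim3b's inventory: shim-p1's `…InertShiftDescent` (p481169), re-keyed

* `exists_hypothesesM_of_leavesM_shift_ofImage` — `KolyvaginDescent.HypothesesM` on `H¹(K, E[p^M])` from the
  two leaves asked only at depth-`(M+k)` Kolyvagin primes; the `cebotarev` field is I2's
  `McCallum1991_cor_3_2_pow_shift_of_chebotarev_ofImage`.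
* `pow_smul_sha_primary_eq_zero_at_of_leavesM_shift_ofImage` — `p^{2m} · Ш(E/K)[p^∞] = 0` from the shifted
  leaves (McCallum 1991 §1 Theorem, exponent form).
Statements ∕ proofs VERBATIM shim-p1's except the binder `hρ` ↦ `(hIz) (hIs) (hIc) (hIt)` and the torsion leaf
`torsionBy_eq_bot_of_isImaginaryQuadratic … hρ` ↦ `hIt`.
[cite: McCallumLMS1991, §1 Theorem (Kolyvagin), §3 Cor. 3.2, §4 (4)–(6), Lemma 4.3, Prop. 4.4, Lemma 4.6, §5 Lemmas 5.1, 5.3]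
[cite: GrossLMS1991, §1 Thm. 1.3 (2), Prop. 2.1 (2), §§3–5, §10] [cite: Howard2004Duke, Thm. 3.2.2 (proof)]
presearch: as I2 (cell D8 audit; shim3b g5 §1: corpus + galaxy, nothing at p = 3 non-surjective).
-/

noncomputable section

open scoped Classical

set_option linter.dupNamespace false

universe u

namespace Summit.BirchSwinnertonDyer.BirchSwinnertonDyer.Theorems.ShimuraKolyvaginOfImage

open WeierstrassCurve NumberField IsDedekindDomain Field
  Literature.NumberTheory.EllipticCurves Literature.NumberTheory.GaloisRepresentations
  Literature.NumberTheory.EllipticCurves.KolyvaginDescent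

/-! ### §1 The descent data modulo `p^M` from leaves asked at depth-`(M+k)` Kolyvagin primes -/

section Leaves

variable {N : ℕ} [NeZero N] {W : WeierstrassCurve ℚ} {K : Type u} [Field K] [NumberField K]

/-- **`HypothesesM` at level `p^M` with Kolyvagin primes of depth `M + k`.** The statement and proof of
x11b3's `KolyvaginDescent.exists_hypothesesM_of_leavesM` VERBATIM, except that the two leaves — (A)
Kolyvagin's classes `c_M(n)` with their signs, Selmer conditions off `n` and McCallum's Prop. 4.4, (B)
McCallum's Lemma 5.3 with Prop. 2.2 — are asked only for the square-free products of Kolyvagin primes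
`ℓ` with `Frob(ℓ) = Frob(∞)` on `E[p^{M+k}]` (instead of `E[p^M]`), and the structure's predicate `Kol` is
that smaller set; its `cebotarev` field is then McCallum's Cor. 3.2 one level deeper
(`McCallum1991_cor_3_2_pow_shift_of_chebotarev_ofImage`). This is the descent of the level-shift road (McCallum
§§4–5 with `S_r(M) ↦ S_r(M+k)`, Lemma 4.6). [cite: McCallumLMS1991, §4 (6), Lemma 4.3, Prop. 4.4,
Lemma 4.6; §5 Lemma 5.1, Lemma 5.3; §3 Cor. 3.2] [cite: GrossLMS1991, Props. 5.3, 5.4 (2)] -/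
theorem exists_hypothesesM_of_leavesM_shift_ofImage [W.IsElliptic] (hK : IsImaginaryQuadratic K)
    {P : (W.baseChange K).toAffine.Point} {p : ℕ} (hp : p.Prime) (hp2 : p ≠ 2)
    (hIz : ∃ z : absoluteGaloisGroup K, ∀ t : geomTorsion (W.baseChange K) p, z • t = -t)
    (hIs : (W.baseChange K).HasIrreducibleModPGaloisRep p)
    (hIc : ∀ f : geomTorsion (W.baseChange K) p →+ geomTorsion (W.baseChange K) p,
      (∀ (g : absoluteGaloisGroup K) (t : geomTorsion (W.baseChange K) p), f (g • t) = g • f t) →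
        ∃ k : ℤ, ∀ t, f t = k • t)
    (hIt : AddSubgroup.torsionBy (W.baseChange K).toAffine.Point (p : ℤ) = ⊥) (hC : Literature.NumberTheory.Automorphic.chebotarev_artinRep)
    (hW : W.exists_weilPairing p) {M : ℕ} (hM : 1 ≤ M) (k : ℕ)
    (hdiv : ∀ Q : geomPoints (W.baseChange K), ∃ R, ((p ^ M : ℕ) : ℤ) • R = Q)
    {c : K ≃ₐ[ℚ] K} (hc : c ≠ 1) (hcc : c * c = 1)
    {M₀ : ℕ} {x₀ : (W.baseChange K).toAffine.Point} (hx₀ : p ^ M₀ • x₀ = P)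
    (hPx : kummerMapTorsion (W.baseChange K) _ hdiv P =
      ((p : ℤ) ^ M₀) • kummerMapTorsion (W.baseChange K) _ hdiv x₀)
    (hxord : ((p : ℤ) ^ (M - 1)) • kummerMapTorsion (W.baseChange K) _ hdiv x₀ ≠ 0)
    (ε : ℤ) (hε : ε = 1 ∨ ε = -1)
    (h53 : IsOfFinAddOrder (Affine.Point.map (W' := W) (c : K →ₐ[ℚ] K) P - ε • P))
    (cl : ℕ → galH1Torsion (W.baseChange K) ((p ^ M : ℕ) : ℤ))
    (hc1 : cl 1 = kummerMapTorsion (W.baseChange K) _ hdiv P)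
    (hcl : ∀ m : ℕ, Squarefree m →
      (∀ q ∈ m.primeFactors, IsKolyvaginPrime N W K p q ∧ FrobEqFrobInfty W K (p ^ (M + k)) q) →
      conjAct W c _ (cl m) = (ε * (-1) ^ m.primeFactors.card) • cl m ∧
      (∀ v : HeightOneSpectrum (𝓞 K), (m : 𝓞 K) ∉ v.asIdeal →
        cl m ∈ selmerLocalKer (W.baseChange K) (v.adicCompletion K) ((p ^ M : ℕ) : ℤ)) ∧
      (∀ ℓ : ℕ, ℓ.Prime → ℓ ∣ m → ∀ v : HeightOneSpectrum (𝓞 K), (ℓ : 𝓞 K) ∈ v.asIdeal →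
        ∀ a : ℕ, (((p : ℤ) ^ a) • cl m ∈
            selmerLocalKer (W.baseChange K) (v.adicCompletion K) ((p ^ M : ℕ) : ℤ) ↔
          ((p : ℤ) ^ a) • cl (m / ℓ) ∈
            (W.baseChange K).torsionLocalKer (v.adicCompletion K) ((p ^ M : ℕ) : ℤ))))
    (hdual : ∀ ℓ : ℕ, IsKolyvaginPrime N W K p ℓ ∧ FrobEqFrobInfty W K (p ^ (M + k)) ℓ →
      ∀ ν : ℤ, (ν = 1 ∨ ν = -1) → ∀ d : galH1Torsion (W.baseChange K) ((p ^ M : ℕ) : ℤ),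
      conjAct W c _ d = ν • d →
      (∀ v : HeightOneSpectrum (𝓞 K), (ℓ : 𝓞 K) ∉ v.asIdeal →
        d ∈ selmerLocalKer (W.baseChange K) (v.adicCompletion K) ((p ^ M : ℕ) : ℤ)) →
      (∀ w : InfinitePlace K, d ∈ selmerLocalKer (W.baseChange K) w.Completion ((p ^ M : ℕ) : ℤ)) →
      ∀ s ∈ selmerGroup (W.baseChange K) ((p ^ M : ℕ) : ℤ), conjAct W c _ s = ν • s →
      ∀ a : ℕ, a < M → ∀ v : HeightOneSpectrum (𝓞 K), (ℓ : 𝓞 K) ∈ v.asIdeal →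
        ((p : ℤ) ^ a) • d ∉ selmerLocalKer (W.baseChange K) (v.adicCompletion K) ((p ^ M : ℕ) : ℤ) →
        ((p : ℤ) ^ (M - 1 - a)) • s ∈
          (W.baseChange K).torsionLocalKer (v.adicCompletion K) ((p ^ M : ℕ) : ℤ)) :
    ∃ S : HypothesesM (galH1Torsion (W.baseChange K) ((p ^ M : ℕ) : ℤ))
        (HeightOneSpectrum (𝓞 K) ⊕ InfinitePlace K),
      S.Sel = selmerGroup (W.baseChange K) ((p ^ M : ℕ) : ℤ) ∧
      S.x = kummerMapTorsion (W.baseChange K) _ hdiv x₀ ∧ S.p = p ∧ S.M₀ = M₀ ∧ S.M = M := by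
  -- adapted from x11b3's `KolyvaginDescent.exists_hypothesesM_of_leavesM` (Kol ↦ depth `M + k`)
  have hn0 : ((p ^ M : ℕ) : ℤ) ≠ 0 := by exact_mod_cast pow_ne_zero M hp.ne_zero
  -- `E(K)[p] = 0`
  have hbot := hIt
  have hA : ∀ a : (W.baseChange K).toAffine.Point, p • a = 0 → a = 0 := fun a ha ↦ by
    have : a ∈ AddSubgroup.torsionBy (W.baseChange K).toAffine.Point (p : ℤ) := by
      rw [mem_torsionBy_iff, natCast_zsmul]; exact ha
    rw [hbot] at this
    exact this
  -- `τ x = ε x`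
  set x := kummerMapTorsion (W.baseChange K) _ hdiv x₀ with hxdef
  have hτx : conjAct W c _ x = ε • x := by
    rw [hxdef, conjAct_kummerMapTorsion W c _ hdiv x₀]
    set t := Affine.Point.map (W' := W) (c : K →ₐ[ℚ] K) x₀ - ε • x₀ with ht
    have htP : p ^ M₀ • t = Affine.Point.map (W' := W) (c : K →ₐ[ℚ] K) P - ε • P := by
      rw [ht, smul_sub, ← map_nsmul, hx₀, smul_comm, hx₀]
    have htors : IsOfFinAddOrder t := by
      obtain ⟨k', hk', hkt⟩ := (isOfFinAddOrder_iff_nsmul_eq_zero).mp h53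
      refine (isOfFinAddOrder_iff_nsmul_eq_zero).mpr
        ⟨k' * p ^ M₀, Nat.mul_pos hk' (pow_pos hp.pos _), ?_⟩
      rw [mul_smul, htP, hkt]
    obtain ⟨s, hs⟩ := exists_pow_smul_eq_of_isOfFinAddOrder hp hA htors M
    have hker : t ∈ (kummerMapTorsion (W.baseChange K) ((p ^ M : ℕ) : ℤ) hdiv).ker := by
      rw [kummerMapTorsion_ker]
      exact ⟨s, by rw [← hs, Nat.cast_pow]; rfl⟩
    have ht0 : kummerMapTorsion (W.baseChange K) _ hdiv t = 0 := hker
    have : Affine.Point.map (W' := W) (c : K →ₐ[ℚ] K) x₀ = t + ε • x₀ := by rw [ht]; abel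
    rw [this, map_add, ht0, zero_add, map_zsmul]
  -- the local conditions at the (complex) infinite places are empty
  have hinf : ∀ (w : InfinitePlace K) (y : galH1Torsion (W.baseChange K) ((p ^ M : ℕ) : ℤ)),
      y ∈ selmerLocalKer (W.baseChange K) w.Completion ((p ^ M : ℕ) : ℤ) := fun w y ↦ by
    haveI : IsAlgClosed w.Completion :=
      isAlgClosed_of_ringEquiv (InfinitePlace.Completion.ringEquivComplexOfIsComplex
        (hK.2.isComplex w)).symm
    rw [WeierstrassCurve.selmerLocalKer_eq_top_of_isAlgClosed]
    trivial
  -- the structure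
  refine ⟨
    { p := p
      hp := hp
      hp2 := hp2
      M := M
      torsion := fun v ↦ by
        have := zsmul_discreteH1_torsion ((p ^ M : ℕ) : ℤ) v
        exact_mod_cast this
      τ := conjAct W c _
      τ_τ := conjAct_conjAct_of_mul_self W hcc _
      Sel := selmerGroup (W.baseChange K) _
      τ_mem := fun s hs ↦ conjAct_mem_selmerGroup W hK.2.isComplex c _ hs
      Loc := Sum.elim (fun v ↦ selmerLocalKer (W.baseChange K) (v.adicCompletion K) _)
        (fun w ↦ selmerLocalKer (W.baseChange K) w.Completion _)
      mem_sel_iff := fun s ↦ by rw [mem_selmerGroup_iff, Sum.forall]; rfl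
      Kol := fun ℓ ↦ IsKolyvaginPrime N W K p ℓ ∧ FrobEqFrobInfty W K (p ^ (M + k)) ℓ
      prime_of_kol := fun ℓ h ↦ h.1.prime
      pl := fun ℓ ↦ if h : IsKolyvaginPrime N W K p ℓ ∧ FrobEqFrobInfty W K (p ^ (M + k)) ℓ then
          Sum.inl h.1.place else Sum.inr (Classical.arbitrary _)
      Dv := fun v n ↦ Sum.elim (fun v ↦ (n : 𝓞 K) ∈ v.asIdeal) (fun _ ↦ False) v
      dv_iff := fun ℓ hℓ v ↦ by
        rw [dif_pos hℓ]
        rcases v with v | w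
        · simp only [Sum.elim_inl, Sum.inl.injEq]
          exact hℓ.1.mem_iff
        · simp
      dv_mul := fun ℓ ℓ' _ _ v ↦ by
        rcases v with v | w
        · exact natCast_mul_mem_asIdeal
        · simp
      A := fun ℓ ↦ ⨅ (v : HeightOneSpectrum (𝓞 K)) (_ : (ℓ : 𝓞 K) ∈ v.asIdeal),
        (W.baseChange K).torsionLocalKer (v.adicCompletion K) _
      x := x
      x_mem := (mem_selmerGroup_iff _ _ _).mpr
        ⟨fun _ ↦ kummerMapTorsion_mem_selmerLocalKer _ _ _ _ x₀,
          fun _ ↦ kummerMapTorsion_mem_selmerLocalKer _ _ _ _ x₀⟩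
      x_ord := hxord
      M₀ := M₀
      ε := ε
      hε := hε
      τ_x := hτx
      c := cl
      c_one := by rw [hc1, hPx]
      τ_c := fun n hn ↦ (hcl n hn.1 hn.2).1
      c_mem_loc := fun n hn v hv ↦ by
        rcases v with v | w
        · exact (hcl n hn.1 hn.2).2.1 v hv
        · exact hinf w (cl n)
      c_mem_loc_iff := fun ℓ m hℓ hn a ↦ by
        rw [dif_pos hℓ]
        simp only [Sum.elim_inl, AddSubgroup.mem_iInf]
        have key := (hcl (ℓ * m) hn.1 hn.2).2.2 ℓ hℓ.1.prime (dvd_mul_right ℓ m) hℓ.1.place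
          hℓ.1.mem_place a
        rw [Nat.mul_div_cancel_left m hℓ.1.prime.pos] at key
        rw [key]
        constructor
        · intro h v hv
          rwa [hℓ.1.mem_iff.mp hv]
        · intro h
          exact h hℓ.1.place hℓ.1.mem_place
      duality := fun ℓ hℓ ν hν d hd hoff s hs hτs a ha hat ↦ by
        rw [dif_pos hℓ] at hoff hat
        simp only [AddSubgroup.mem_iInf]
        intro v hv
        refine hdual ℓ hℓ ν hν d hd (fun v' hv' ↦ ?_) (fun w ↦ ?_) s hs hτs a ha v hv ?_
        · exact hoff (Sum.inl v') (fun h ↦ hv' (hℓ.1.mem_iff.mpr (Sum.inl_injective h)))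
        · exact hoff (Sum.inr w) (by simp)
        · rwa [hℓ.1.mem_iff.mp hv]
      cebotarev := fun r cs Nv h0 hN hτ hind b ↦ by
        obtain ⟨ℓ, hlt, hKol, hfrob, hloc⟩ := McCallum1991_cor_3_2_pow_shift_of_chebotarev_ofImage (N := N)
          hC hK hp hp2 hIz hIs hIc hIt hW hM k hc cs h0 Nv hN hτ hind b
        refine ⟨ℓ, hlt, ⟨hKol, hfrob⟩, fun i ↦ ⟨?_, fun hNi h ↦ ?_⟩⟩
        · simp only [AddSubgroup.mem_iInf]
          intro v hv
          exact (hloc i v hv).1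
        · simp only [AddSubgroup.mem_iInf] at h
          exact (hloc i hKol.place hKol.mem_place).2 hNi (h hKol.place hKol.mem_place) },
    rfl, rfl, rfl, rfl, rfl⟩

/-! ### §2 The exponent form `p^{2m} · Ш(E/K)[p^∞] = 0` from the shifted leaves -/

/-- **`p^{2m} · Ш(E/K)[p^∞] = 0` at one odd prime `p` with `ρ̄_{E,p}` onto, for every `m` with
`p^{m+1} ∤ y_K` in `E(K)`, from the mod-`p^M` leaves (A) + (B) asked ONLY at Kolyvagin primes of depth
`M + k`.** Statement and proof of x11b3's `KolyvaginDescent.pow_smul_sha_primary_eq_zero_at_of_leavesM`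
VERBATIM with `FrobEqFrobInfty W K (p^M)` replaced by `FrobEqFrobInfty W K (p^(M+k))` in `hleaves` and
§1 in place of `exists_hypothesesM_of_leavesM`. [cite: McCallumLMS1991, §1 Theorem (Kolyvagin), Lemma 5.1,
Lemma 4.6] [cite: GrossLMS1991, §1 Thm. 1.3 (2), §10] -/
theorem pow_smul_sha_primary_eq_zero_at_of_leavesM_shift_ofImage [W.IsElliptic] (hK : IsImaginaryQuadratic K)
    {P : (W.baseChange K).toAffine.Point} (hnt : ¬ IsOfFinAddOrder P) {p : ℕ} (hp : p.Prime)
    (hp2 : p ≠ 2) (hIz : ∃ z : absoluteGaloisGroup K, ∀ t : geomTorsion (W.baseChange K) p, z • t = -t)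
    (hIs : (W.baseChange K).HasIrreducibleModPGaloisRep p)
    (hIc : ∀ f : geomTorsion (W.baseChange K) p →+ geomTorsion (W.baseChange K) p,
      (∀ (g : absoluteGaloisGroup K) (t : geomTorsion (W.baseChange K) p), f (g • t) = g • f t) →
        ∃ k : ℤ, ∀ t, f t = k • t)
    (hIt : AddSubgroup.torsionBy (W.baseChange K).toAffine.Point (p : ℤ) = ⊥) {m : ℕ} (k : ℕ)
    (hm : ∀ Q : (W.baseChange K).toAffine.Point, p ^ (m + 1) • Q ≠ P)
    (hC : Literature.NumberTheory.Automorphic.chebotarev_artinRep) (hW : W.exists_weilPairing p)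
    (hleaves : ∀ {M : ℕ} (_hM : 1 ≤ M)
      (hdiv : ∀ Q : geomPoints (W.baseChange K), ∃ R, ((p ^ M : ℕ) : ℤ) • R = Q)
      (c : K ≃ₐ[ℚ] K) (_hc : c ≠ 1),
      ∃ (ε : ℤ) (cl : ℕ → galH1Torsion (W.baseChange K) ((p ^ M : ℕ) : ℤ)),
        (ε = 1 ∨ ε = -1) ∧
        IsOfFinAddOrder (Affine.Point.map (W' := W) (c : K →ₐ[ℚ] K) P - ε • P) ∧
        cl 1 = kummerMapTorsion (W.baseChange K) _ hdiv P ∧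
        (∀ m : ℕ, Squarefree m →
          (∀ q ∈ m.primeFactors, IsKolyvaginPrime N W K p q ∧ FrobEqFrobInfty W K (p ^ (M + k)) q) →
          conjAct W c _ (cl m) = (ε * (-1) ^ m.primeFactors.card) • cl m ∧
          (∀ v : HeightOneSpectrum (𝓞 K), (m : 𝓞 K) ∉ v.asIdeal →
            cl m ∈ selmerLocalKer (W.baseChange K) (v.adicCompletion K) ((p ^ M : ℕ) : ℤ)) ∧
          (∀ ℓ : ℕ, ℓ.Prime → ℓ ∣ m → ∀ v : HeightOneSpectrum (𝓞 K), (ℓ : 𝓞 K) ∈ v.asIdeal →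
            ∀ a : ℕ, (((p : ℤ) ^ a) • cl m ∈
                selmerLocalKer (W.baseChange K) (v.adicCompletion K) ((p ^ M : ℕ) : ℤ) ↔
              ((p : ℤ) ^ a) • cl (m / ℓ) ∈
                (W.baseChange K).torsionLocalKer (v.adicCompletion K) ((p ^ M : ℕ) : ℤ)))) ∧
        (∀ ℓ : ℕ, IsKolyvaginPrime N W K p ℓ ∧ FrobEqFrobInfty W K (p ^ (M + k)) ℓ →
          ∀ ν : ℤ, (ν = 1 ∨ ν = -1) → ∀ d : galH1Torsion (W.baseChange K) ((p ^ M : ℕ) : ℤ),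
          conjAct W c _ d = ν • d →
          (∀ v : HeightOneSpectrum (𝓞 K), (ℓ : 𝓞 K) ∉ v.asIdeal →
            d ∈ selmerLocalKer (W.baseChange K) (v.adicCompletion K) ((p ^ M : ℕ) : ℤ)) →
          (∀ w : InfinitePlace K,
            d ∈ selmerLocalKer (W.baseChange K) w.Completion ((p ^ M : ℕ) : ℤ)) →
          ∀ s ∈ selmerGroup (W.baseChange K) ((p ^ M : ℕ) : ℤ), conjAct W c _ s = ν • s →
          ∀ a : ℕ, a < M → ∀ v : HeightOneSpectrum (𝓞 K), (ℓ : 𝓞 K) ∈ v.asIdeal →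
            ((p : ℤ) ^ a) • d ∉
              selmerLocalKer (W.baseChange K) (v.adicCompletion K) ((p ^ M : ℕ) : ℤ) →
            ((p : ℤ) ^ (M - 1 - a)) • s ∈
              (W.baseChange K).torsionLocalKer (v.adicCompletion K) ((p ^ M : ℕ) : ℤ))) :
    ∀ d : (W.baseChange K).sha, (∃ j : ℕ, p ^ j • d = 0) → p ^ (2 * m) • d = 0 := by
  -- adapted from x11b3's `KolyvaginDescent.pow_smul_sha_primary_eq_zero_at_of_leavesM`
  haveI : (W.baseChange K).IsElliptic := inferInstanceAs (W.map (algebraMap ℚ K)).IsElliptic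
  obtain ⟨c, hc, hcc⟩ := exists_conj_of_isImaginaryQuadratic K hK
  have hbot := hIt
  have hA : ∀ a : (W.baseChange K).toAffine.Point, p • a = 0 → a = 0 := fun a ha ↦ by
    have : a ∈ AddSubgroup.torsionBy (W.baseChange K).toAffine.Point (p : ℤ) := by
      rw [mem_torsionBy_iff, natCast_zsmul]; exact ha
    rw [hbot] at this
    exact this
  obtain ⟨M₀, x₀, hx₀, -, hgen⟩ := exists_kummer_generator_pow (W.baseChange K) hp hA hnt
  have hM₀m : M₀ ≤ m := by
    by_contra h
    refine hm (p ^ (M₀ - (m + 1)) • x₀) ?_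
    rw [smul_smul, ← pow_add, show m + 1 + (M₀ - (m + 1)) = M₀ by omega, hx₀]
  have hdivj : ∀ j : ℕ, ∀ Q : geomPoints (W.baseChange K), ∃ R, ((p ^ j : ℕ) : ℤ) • R = Q :=
    fun j ↦ (W.baseChange K).zsmul_geomPoints_surjective_holds
      (by exact_mod_cast pow_ne_zero j hp.ne_zero)
  have key : ∀ j : ℕ, 1 ≤ j →
      ∃ S : HypothesesM (galH1Torsion (W.baseChange K) ((p ^ j : ℕ) : ℤ))
          (HeightOneSpectrum (𝓞 K) ⊕ InfinitePlace K),
        S.Sel = selmerGroup (W.baseChange K) ((p ^ j : ℕ) : ℤ) ∧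
        S.x = kummerMapTorsion (W.baseChange K) _ (hdivj j) x₀ ∧ S.p = p ∧ S.M₀ = M₀ ∧
        S.M = j := by
    intro j hj
    obtain ⟨ε, cl, hε, h53, hc1, hcl, hdual⟩ := hleaves hj (hdivj j) c hc
    obtain ⟨hPx, hxord⟩ := hgen j (by omega) (hdivj j)
    exact exists_hypothesesM_of_leavesM_shift_ofImage (N := N) hK hp hp2 hIz hIs hIc hIt hC hW hj k (hdivj j) hc hcc
      hx₀ hPx hxord ε hε h53 cl hc1 hcl hdual
  choose S hS using key
  intro d hd
  have h2M₀ : p ^ (2 * M₀) • d = 0 :=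
    pow_smul_sha_primary_eq_zero_of_hypothesesM_of_le (W.baseChange K) hp M₀ 1 S
      (fun j hj ↦ (hS j hj).2.2.1) (fun j hj ↦ (hS j hj).2.2.2.1) (fun j hj ↦ (hS j hj).1)
      (fun j hj ↦ by
        rw [(hS j hj).2.1, AddMonoidHom.mem_ker]
        exact torsionH1ToH1_kummerMapTorsion _ _ _ x₀) d hd
  rw [show 2 * m = (2 * m - 2 * M₀) + 2 * M₀ by omega, pow_add, mul_smul, h2M₀, smul_zero]

end Leaves

end Summit.BirchSwinnertonDyer.BirchSwinnertonDyer.Theorems.ShimuraKolyvaginOfImage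

end
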